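import Literature.AlgebraicGeometry.Resolution.OneDimensionalBlowupTowerLemmas
import HarnessLib

/-!
# The `δ`-invariant of a reduced one-dimensional local ring drops under blowing up a non-regular
# point (Kollár Thm. 1.101, one step, via the total normalization)

Topic: `Literature/AlgebraicGeometry/Resolution`. The STEP of Kollár 2007, Thm. 1.101 (3) ⇒ (1)
[Kru30, Satz 7] via the TOTAL normalization `R̄ ⊆ K` of a reduced local ring (a second route,
independent of the branchwise potential of `OneDimensionalBlowupTowerProof.lean`, which
discharges the named fact `Kollar2007_thm_1_101_localChain`): let `π : X' → X` be a blowing up along `D` with `D_x = 𝔪_x`,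
where `S = 𝒪_{X,x}` is a reduced Noetherian local ring of dimension one with module-finite
normalization which is NOT regular, and `x' ∈ X'` a point over `x`. Then `S' = 𝒪_{X',x'}` is
again reduced, Noetherian, of dimension one with module-finite normalization, and
**`length_{S'}(S̄'/S') < length_S(S̄/S)`**. Assembly of the ring-theoretic files
`QuadraticTransform*.lean` with the chart dictionary `IsBlowup.exists_reesChart_stalk`
(`BlowupStalkCharts.lean`): `S'` is the localization of the chart ring `S[𝔪/c] ≅ (S[𝔪t])_{(ct)}`
at a prime over `𝔪`, the generators of `𝔪` being chosen non-zero-divisors, and the chart ring is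
realised inside the total ring of fractions `L`, with `L_𝔴` as total ring of fractions of `S'`.

* `krullTower_step_of_subalgebra` — the step for `S' = B_𝔴`, `B ⊆ L` a chart subalgebra;
* `krullTower_step_of_chart` — the step for `S'` a localization of the Rees chart ring;
* `IsBlowup.krullTower_step` — **the step for a blowing up** `π : X' → X` at `x' ↦ x`.

No definitions, no named facts. Sources: J. Kollár, *Lectures on Resolution of Singularities*
(2007), §1.13, Thm. 1.101, Lemma 1.99 [Kollar2007]; The Stacks Project, Tag 0804 [StacksProject].
-/

noncomputable section

open IsLocalRing Polynomial nonZeroDivisors CategoryTheory AlgebraicGeometry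
open Literature.RingTheory.HilbertSamuel

namespace Literature.AlgebraicGeometry.Resolution

universe u

/-! ## The step, for abstract local rings presented by a chart subalgebra -/

section StepSubalgebra

/-- **One step of Krull's blow-up tower, algebraic form over a chart subalgebra** (Kollár
Thm. 1.101 (3) ⇒ (1)): `S` reduced Noetherian local of dimension one with module-finite
normalization in `L`, not regular; `c ∈ 𝔪` a non-zero-divisor; `𝔪/c ⊆ B ⊆ ⋃ 𝔪ⁿ/cⁿ` a
Noetherian subalgebra of `L`; `𝔴 ⊆ B` a prime over `𝔪`; `S' = B_𝔴` with `dim S' ≤ 1`. Then `S'`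
is reduced, Noetherian, of dimension one, with module-finite normalization, and
`length_{S'}(S̄'/S') < length_S(S̄/S)` — with `Q' = L_𝔴` as total ring of fractions of `S'`.
[cite: Kollar2007, Thm. 1.101] -/
theorem krullTower_step_of_subalgebra (S : Type u) [CommRing S] [IsLocalRing S]
    [IsNoetherianRing S] [IsReduced S] (hdim : ringKrullDim S = 1) (L : Type u) [CommRing L]
    [Algebra S L] [IsFractionRing S L] [Module.Finite S (integralClosure S L)]
    (hreg : ¬ IsRegularLocalRing S) {B : Subalgebra S L} [IsNoetherianRing B] (𝔴 : Ideal B)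
    [𝔴.IsPrime] (h𝔴 : 𝔴.comap (algebraMap S B) = maximalIdeal S) (S' : Type u) [CommRing S']
    [IsLocalRing S'] [Algebra B S'] [IsLocalization.AtPrime S' 𝔴] [Algebra S S']
    [IsScalarTower S B S'] {c : S} (hc : c ∈ maximalIdeal S) (hc0 : c ∈ S⁰)
    (hB1 : ∀ m ∈ maximalIdeal S, ∃ b ∈ B, algebraMap S L m = algebraMap S L c * b)
    (hB2 : ∀ b ∈ B, ∃ n : ℕ, ∃ m ∈ maximalIdeal S ^ n,
      algebraMap S L (c ^ n) * b = algebraMap S L m)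
    (hdim' : ringKrullDim S' ≤ 1) :
    IsNoetherianRing S' ∧ IsReduced S' ∧ ringKrullDim S' = 1 ∧
      Module.Finite S' (integralClosure S' (FractionRing S')) ∧
      Module.length S' (↥(integralClosure S' (FractionRing S')) ⧸
          LinearMap.range (Algebra.linearMap S' ↥(integralClosure S' (FractionRing S')))) <
        Module.length S (↥(integralClosure S L) ⧸
          LinearMap.range (Algebra.linearMap S ↥(integralClosure S L))) := by
  classical
  -- the total ring of fractions `Q' = L_𝔴` of `S'` (kept abstract: only a localization of `L`)
  obtain ⟨Q', _, _, _⟩ : ∃ (Q' : Type u) (_ : CommRing Q') (_ : Algebra L Q'),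
      IsLocalization (𝔴.primeCompl.map (algebraMap B L)) Q' :=
    ⟨Localization (𝔴.primeCompl.map (algebraMap B L)), inferInstance, inferInstance, inferInstance⟩
  have hunits : ∀ y : 𝔴.primeCompl, IsUnit (((algebraMap L Q').comp (algebraMap B L)) y) := by
    intro y
    rw [RingHom.comp_apply]
    exact IsLocalization.map_units (M := 𝔴.primeCompl.map (algebraMap B L)) Q'
      ⟨algebraMap B L y, Submonoid.mem_map_of_mem (algebraMap B L) y.2⟩
  letI algOQ : Algebra S' Q' :=
    (IsLocalization.lift (M := 𝔴.primeCompl) (S := S') hunits).toAlgebra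
  letI algSQ : Algebra S Q' := ((algebraMap L Q').comp (algebraMap S L)).toAlgebra
  haveI : IsScalarTower S L Q' := IsScalarTower.of_algebraMap_eq fun r => rfl
  haveI : IsScalarTower B S' Q' := IsScalarTower.of_algebraMap_eq fun b =>
    (IsLocalization.lift_eq (M := 𝔴.primeCompl) (S := S') hunits b).symm
  haveI : IsScalarTower S S' Q' := IsScalarTower.of_algebraMap_eq fun r => by
    rw [IsScalarTower.algebraMap_apply S B S' r]
    change algebraMap L Q' (algebraMap S L r) =
      IsLocalization.lift (M := 𝔴.primeCompl) (S := S') hunits (algebraMap B S' (algebraMap S B r))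
    rw [IsLocalization.lift_eq]
    rfl
  -- `S` is not regular: `𝔪` is not principal and `S̄ ≠ S`
  have hnp : ∀ x : S, maximalIdeal S ≠ Ideal.span {x} := by
    intro x hx
    apply hreg
    apply IsRegularLocalRing.of_spanFinrank_maximalIdeal_le
    rw [hdim, hx]
    have h1 : (Ideal.span {x}).spanFinrank ≤ ({x} : Set S).ncard :=
      Submodule.spanFinrank_span_le_ncard_of_finite (Set.finite_singleton x)
    rw [Set.ncard_singleton] at h1
    exact_mod_cast h1
  have hN : ∃ n ∈ integralClosure S L, n ∉ Set.range (algebraMap S L) := by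
    by_contra h
    push Not at h
    exact hreg (isRegularLocalRing_of_integralClosure_le S L hdim h)
  -- conclude
  have hlt := QuadraticTransform.length_quotient_lt 𝔴 S' Q' hdim hc hc0 hB1 hB2 hnp hN
  have hfin' := QuadraticTransform.module_finite_integralClosure 𝔴 S' Q' hdim hc hc0 hB1 hB2
  haveI hfr : IsFractionRing S' Q' := QuadraticTransform.isFractionRing 𝔴 S' Q'
  have hred' : IsReduced S' := QuadraticTransform.isReduced 𝔴 S' Q'
  have hnoeth' : IsNoetherianRing S' := QuadraticTransform.isNoetherianRing 𝔴 S'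
  have hc𝔴 : algebraMap S B c ∈ 𝔴 := by
    have : c ∈ 𝔴.comap (algebraMap S B) := by rw [h𝔴]; exact hc
    exact this
  have hge : 1 ≤ ringKrullDim S' := QuadraticTransform.one_le_ringKrullDim 𝔴 S' Q' hc0 hc𝔴
  haveI := hfin'
  refine ⟨hnoeth', hred', le_antisymm hdim' hge,
    module_finite_integralClosure_of_isFractionRing_total S' Q' (FractionRing S'), ?_⟩
  rw [length_normalizationQuotient_eq_of_isFractionRing S' (FractionRing S') Q']
  exact hlt

end StepSubalgebra

/-! ## The step, for abstract local rings presented by a chart -/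

section StepChart

-- The final `exact` unifies a large instance-laden statement (chart ring, subalgebra, two
-- localizations); it elaborates in ≈ 25 s but needs more than the default heartbeats.
set_option maxHeartbeats 1600000 in
/-- **One step of Krull's blow-up tower, algebraic form** (Kollár Thm. 1.101 (3) ⇒ (1)): let `S`
be a reduced Noetherian local ring of dimension one with module-finite normalization which is
NOT regular, `𝔪 = (c₁, …, c_k)` with every `cᵢ` a non-zero-divisor, and `S'` a localization of
the chart ring `(S[𝔪t])_{(c_j t)}` at a prime `𝔴` over `𝔪`. Then `S'` is reduced, Noetherian, of
dimension one, with module-finite normalization, and `length_{S'}(S̄'/S') < length_S(S̄/S)`: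
the chart ring is realised as `B = S[𝔪/c_j]` inside the total ring of fractions `L` of `S`
(`reesChartEquiv`, Stacks 0804), so `S' = B_𝔴`. [cite: Kollar2007, Thm. 1.101] -/
theorem krullTower_step_of_chart (S : Type u) [CommRing S] [IsLocalRing S] [IsNoetherianRing S]
    [IsReduced S] (hdim : ringKrullDim S = 1) (L : Type u) [CommRing L] [Algebra S L]
    [IsFractionRing S L] [Module.Finite S (integralClosure S L)] (hreg : ¬ IsRegularLocalRing S)
    {k : ℕ} (c : Fin k → S) (hc : Ideal.span (Set.range c) = maximalIdeal S)
    (hc0 : ∀ i, c i ∈ S⁰) (j : Fin k) (𝔴 : PrimeSpectrum (chartRing c j))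
    (S' : Type u) [CommRing S'] [IsLocalRing S'] (χ : chartRing c j →+* S')
    (hloc : @IsLocalization.AtPrime _ _ S' _ χ.toAlgebra 𝔴.asIdeal _)
    (h𝔴 : 𝔴.asIdeal.comap (chartBase c j) = maximalIdeal S) :
    IsNoetherianRing S' ∧ IsReduced S' ∧ ringKrullDim S' = 1 ∧
      Module.Finite S' (integralClosure S' (FractionRing S')) ∧
      Module.length S' (↥(integralClosure S' (FractionRing S')) ⧸
          LinearMap.range (Algebra.linearMap S' ↥(integralClosure S' (FractionRing S')))) <
        Module.length S (↥(integralClosure S L) ⧸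
          LinearMap.range (Algebra.linearMap S ↥(integralClosure S L))) := by
  classical
  have hcj : c j ∈ Ideal.span (Set.range c) := Ideal.mem_span_range_self (f := c) (x := j)
  have hcj𝔪 : c j ∈ maximalIdeal S := hc ▸ hcj
  letI algRC : Algebra S (chartRing c j) := (chartBase c j).toAlgebra
  letI algCO : Algebra (chartRing c j) S' := χ.toAlgebra
  letI algCS : Algebra (chartRing c j) (Localization.Away (c j)) := (reesChart (c j) hcj).toAlgebra
  haveI hT2 := IsScalarTower.of_algebraMap_eq (R := S) (S := chartRing c j)
    (A := Localization.Away (c j)) fun r => (reesChart_reesChartBase (c j) hcj r).symm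
  haveI : Algebra.FiniteType S (chartRing c j) := finiteType_chart c j
  haveI : IsLocalization.AtPrime S' 𝔴.asIdeal := hloc
  haveI : 𝔴.asIdeal.LiesOver (maximalIdeal S) := ⟨h𝔴.symm⟩
  have hinjC : Function.Injective (algebraMap (chartRing c j) (Localization.Away (c j))) :=
    reesChart_injective (c j) hcj
  -- (1) `dim S' ≤ 1`
  have hdim' : ringKrullDim S' ≤ 1 :=
    (ringKrullDim_le_of_isLocalization_chart (Submonoid.powers (c j)) (Localization.Away (c j))
      (chartRing c j) 𝔴.asIdeal S' hinjC).trans hdim.le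
  haveI : IsNoetherianRing (chartRing c j) := Algebra.FiniteType.isNoetherianRing S (chartRing c j)
  -- (2) the chart ring inside the total ring of fractions `L`
  have hcu : IsUnit (algebraMap S L (c j)) := IsLocalization.map_units L ⟨c j, hc0 j⟩
  let f₀ : Localization.Away (c j) →+* L := IsLocalization.Away.lift (c j) hcu
  have hf₀ : ∀ r : S, f₀ (algebraMap S (Localization.Away (c j)) r) = algebraMap S _ r :=
    fun r => IsLocalization.Away.lift_eq (c j) hcu r
  let f : Localization.Away (c j) →ₐ[S] L :=
    { f₀ with commutes' := hf₀ }
  have hf : ∀ z, f z = f₀ z := fun z => rfl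
  have hfinj : Function.Injective f := by
    rw [injective_iff_map_eq_zero]
    intro z hz
    obtain ⟨⟨r, s⟩, hrs⟩ := IsLocalization.mk'_surjective (Submonoid.powers (c j)) z
    subst hrs
    change f (IsLocalization.mk' (Localization.Away (c j)) r s) = 0 at hz
    change IsLocalization.mk' (Localization.Away (c j)) r s = 0
    have h1 : f (IsLocalization.mk' (Localization.Away (c j)) r s) *
        f (algebraMap S (Localization.Away (c j)) s) = f (algebraMap S _ r) := by
      rw [← map_mul, IsLocalization.mk'_spec]
    rw [hz, zero_mul, hf, hf₀] at h1
    have hr : r = 0 := IsFractionRing.injective S L (by rw [← h1, map_zero])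
    rw [hr, IsLocalization.mk'_zero]
  let Bₐ := blowupAlgebra (Ideal.span (Set.range c)) (c j)
  let B : Subalgebra S L := Bₐ.map f
  let e₁ : chartRing c j ≃+* Bₐ := reesChartEquiv (c j) hcj
  let e₂ : Bₐ ≃ₐ[S] B := Subalgebra.equivMapOfInjective Bₐ f hfinj
  let e : chartRing c j ≃+* B := e₁.trans e₂.toRingEquiv
  have he : ∀ r : S, e (chartBase c j r) = algebraMap S B r := fun r => by
    change e₂ (e₁ (chartBase c j r)) = _
    rw [show e₁ (chartBase c j r) = algebraMap S Bₐ r from reesChartEquiv_reesChartBase (c j) hcj r]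
    exact e₂.commutes r
  haveI hBnoeth : IsNoetherianRing B := isNoetherianRing_of_ringEquiv (chartRing c j) e
  -- the chart hypotheses (these need the definition of `B`)
  have hB1 : ∀ m ∈ maximalIdeal S, ∃ b ∈ B, algebraMap S L m = algebraMap S L (c j) * b := by
    intro m hm
    have hmI : m ∈ Ideal.span (Set.range c) := hc.symm ▸ hm
    refine ⟨f (algebraMap S _ m * IsLocalization.Away.invSelf (c j)),
      Subalgebra.mem_map.mpr ⟨_, div_mem_blowupAlgebra _ (c j) hmI, rfl⟩, ?_⟩
    rw [← f.commutes (c j), mul_comm, ← map_mul, div_mul_algebraMap, f.commutes]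
  have hB2 : ∀ b ∈ B, ∃ n : ℕ, ∃ m ∈ maximalIdeal S ^ n,
      algebraMap S L (c j ^ n) * b = algebraMap S L m := by
    intro b hb
    obtain ⟨y, hy, rfl⟩ := Subalgebra.mem_map.mp hb
    obtain ⟨n, r, hr, hyr⟩ := exists_pow_mul_eq_of_mem_blowupAlgebra hcj hy
    refine ⟨n, r, hc ▸ hr, ?_⟩
    rw [← f.commutes, ← map_mul, hyr, f.commutes]
  -- from now on `B` and `e` are opaque
  clear_value e e₂ B
  -- (3) the prime of `B` through `x'`, and `S' = B_𝔴`
  have he' : ∀ r : S, e.symm.toRingHom (algebraMap S B r) = chartBase c j r := fun r => by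
    rw [← he, RingEquiv.toRingHom_eq_coe, RingEquiv.coe_toRingHom, RingEquiv.symm_apply_apply]
  have h𝔴B : (𝔴.asIdeal.comap e.symm.toRingHom).comap (algebraMap S B) = maximalIdeal S := by
    ext r
    rw [Ideal.mem_comap, Ideal.mem_comap, he', ← h𝔴, Ideal.mem_comap]
  haveI h𝔴Bp : (𝔴.asIdeal.comap e.symm.toRingHom).IsPrime :=
    Ideal.comap_isPrime e.symm.toRingHom 𝔴.asIdeal
  letI algBO : Algebra B S' := ((algebraMap (chartRing c j) S').comp e.symm.toRingHom).toAlgebra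
  have hlocB := isLocalizationAtPrime_comap_symm_of_ringEquiv e 𝔴.asIdeal S' fun b => rfl
  letI algSO : Algebra S S' := ((algebraMap B S').comp (algebraMap S B)).toAlgebra
  haveI htower : IsScalarTower S B S' := IsScalarTower.of_algebraMap_eq fun r => rfl
  exact @krullTower_step_of_subalgebra S _ _ _ _ hdim L _ _ _ _ hreg B hBnoeth
    (𝔴.asIdeal.comap e.symm.toRingHom) h𝔴Bp h𝔴B S' _ _ algBO hlocB algSO htower (c j) hcj𝔪 (hc0 j)
    hB1 hB2 hdim'

end StepChart

/-! ## The step, for a blowing up -/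

section Step

variable {X X' : Scheme.{u}} {π : X' ⟶ X} {D : X.IdealSheafData}

/-- **One step of Krull's blow-up tower** (Kollár Thm. 1.101 (3) ⇒ (1), pointwise): let
`π : X' → X` be a blowing up along `D`, `x' ∈ X'` with `D_{π x'} = 𝔪`, where `S = 𝒪_{X,π x'}` is
a reduced Noetherian local ring of dimension one with module-finite normalization which is NOT
regular. Then `S' = 𝒪_{X',x'}` is reduced, Noetherian, of dimension one, with module-finite
normalization, and `length_{S'}(S̄'/S') < length_S(S̄/S)` (`IsBlowup.exists_reesChart_stalk`
with generators of `𝔪` chosen as non-zero-divisors, then `krullTower_step_of_chart`).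
[cite: Kollar2007, Thm. 1.101] -/
theorem IsBlowup.krullTower_step (hπ : IsBlowup π D) (x' : X')
    (hD : stalkIdeal D (π.base x') = maximalIdeal (X.presheaf.stalk (π.base x')))
    [IsNoetherianRing (X.presheaf.stalk (π.base x'))] [IsReduced (X.presheaf.stalk (π.base x'))]
    (hdim : ringKrullDim (X.presheaf.stalk (π.base x')) = 1)
    [Module.Finite (X.presheaf.stalk (π.base x'))
      (integralClosure (X.presheaf.stalk (π.base x'))
        (FractionRing (X.presheaf.stalk (π.base x'))))]
    (hreg : ¬ IsRegularLocalRing (X.presheaf.stalk (π.base x'))) :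
    IsNoetherianRing (X'.presheaf.stalk x') ∧ IsReduced (X'.presheaf.stalk x') ∧
      ringKrullDim (X'.presheaf.stalk x') = 1 ∧
      Module.Finite (X'.presheaf.stalk x')
        (integralClosure (X'.presheaf.stalk x') (FractionRing (X'.presheaf.stalk x'))) ∧
      Module.length (X'.presheaf.stalk x')
          (↥(integralClosure (X'.presheaf.stalk x') (FractionRing (X'.presheaf.stalk x'))) ⧸
            LinearMap.range (Algebra.linearMap (X'.presheaf.stalk x')
              ↥(integralClosure (X'.presheaf.stalk x') (FractionRing (X'.presheaf.stalk x'))))) <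
        Module.length (X.presheaf.stalk (π.base x'))
          (↥(integralClosure (X.presheaf.stalk (π.base x'))
              (FractionRing (X.presheaf.stalk (π.base x')))) ⧸
            LinearMap.range (Algebra.linearMap (X.presheaf.stalk (π.base x'))
              ↥(integralClosure (X.presheaf.stalk (π.base x'))
                (FractionRing (X.presheaf.stalk (π.base x')))))) := by
  classical
  obtain ⟨k, c, hc, hc0⟩ :=
    exists_span_eq_maximalIdeal_forall_mem_nonZeroDivisors (X.presheaf.stalk (π.base x')) hdim
  obtain ⟨j, 𝔴, χ, -, hloc, h𝔴⟩ := hπ.exists_reesChart_stalk x' c (hc.trans hD.symm)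
  exact krullTower_step_of_chart (X.presheaf.stalk (π.base x')) hdim
    (FractionRing (X.presheaf.stalk (π.base x'))) hreg c hc hc0 j 𝔴 (X'.presheaf.stalk x') χ hloc h𝔴

end Step

end Literature.AlgebraicGeometry.Resolution

end
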